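import Summits.CriticalPhenomena.CardyFormulaZ2.Theorems.HalfPlaneMarkDensityLaw.Negative.MarkEvents
import Literature.Probability.Percolation.ZdOneArmPowerBound
import Literature.Probability.Percolation.BondPercolationSymmetry

/-!
# Line `Sketch`, self-duality programme, Stage II: the end-zone estimate `shortArc_far`
# (crux stmt-CriticalPhenomena-5661, lead c3-0)

A short boundary arc `[p, p+ℓ] × {0}` of the lattice half-plane `H = ℤ × ℕ` of bond-`ℤ²` at
`p = 1/2` is joined inside `H` to a set `T` of sites, all at sup-distance `> ℓ + D` from `(p, 0)`,
only with probability `≤ C ((ℓ+1)/(ℓ+D))^α`: after translating `(p, 0)` to the origin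
(translation invariance of `P_{1/2}`, tree `real_openCrossing_shift`) such a crossing is an open
path from the box `Λ_{ℓ+1}` to the outside of `Λ_{ℓ+D}`, whose probability is bounded by the
tree's a priori one-arm power bound `exists_real_boxToFar_le_rpow_of_le_half`.
-/

noncomputable section

namespace Summit.CriticalPhenomena.CardyFormulaZ2.Cruxes.HalfPlaneMarkDensityLaw.SketchLine.SelfDual

open Literature.Probability.Percolation Literature.Probability.LatticeModels
open MeasureTheory Filter Set SimpleGraph
open Summit.CriticalPhenomena.CardyFormulaZ2.Theorems.HalfPlaneMarkDensityLaw.Negative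

/-- **End-zone estimate.** There are `C, α > 0` such that for every boundary arc
`[p, p+ℓ] × {0}` and every set `T` of sites `f` with `|f 0 - p| > ℓ + D` or `|f 1| > ℓ + D`
(`D ≥ 1`), `P_{1/2}[[p, p+ℓ] × {0} ↔ T in ℤ × ℕ] ≤ C ((ℓ+1)/(ℓ+D))^α`: by translation invariance
and the one-arm power bound `P_{1/2}[Λ_r ↔ Λ_Rᶜ] ≤ C (r/R)^α` at `r = ℓ + 1`, `R = ℓ + D`.
[folklore] -/
theorem shortArc_far : ∃ C α : ℝ, 0 < C ∧ 0 < α ∧ ∀ (p : ℤ) (ℓ D : ℕ) (T : Set (Site 2)),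
    (∀ f ∈ T, (ℓ : ℤ) + D < |f 0 - p| ∨ (ℓ : ℤ) + D < |f 1|) → 1 ≤ D →
      μ.real (openCrossing halfPlane (rowIcc p (p + ℓ)) T) ≤
        C * (((ℓ : ℝ) + 1) / ((ℓ : ℝ) + D)) ^ α := by
  obtain ⟨C, α, hC, hα, h⟩ := exists_real_boxToFar_le_rpow_of_le_half
  refine ⟨C, α, hC, hα, fun p ℓ D T hT hD => ?_⟩
  have hb := h half (by simp) (ℓ + 1) (ℓ + D) (by omega) (by omega)
  have hcast : ((ℓ : ℝ) + 1) / ((ℓ : ℝ) + D) = ((ℓ + 1 : ℕ) : ℝ) / ((ℓ + D : ℕ) : ℝ) := by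
    push_cast; ring
  rw [hcast]
  refine le_trans ?_ hb
  -- translate `(p, 0)` to the origin
  set w : Site 2 := ![p, 0] with hw
  have hsurj : Function.Surjective (fun x : Site 2 => x + w) := fun x => ⟨x - w, sub_add_cancel x w⟩
  have key : openCrossing halfPlane (rowIcc p (p + ℓ)) T =
      openCrossing ((· + w) '' ((· + w) ⁻¹' halfPlane)) ((· + w) '' ((· + w) ⁻¹' rowIcc p (p + ℓ)))
        ((· + w) '' ((· + w) ⁻¹' T)) := by
    rw [image_preimage_eq _ hsurj, image_preimage_eq _ hsurj, image_preimage_eq _ hsurj]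
  rw [key]
  unfold μ
  rw [real_openCrossing_shift]
  -- the translated crossing is an escape from `Λ_{ℓ+1}` to outside `Λ_{ℓ+D}`
  refine measureReal_mono ?_ (measure_ne_top _ _)
  rintro ω ⟨x, hx, y, hy, hxy⟩
  refine ⟨x, ?_, y, ?_, openConnIn_mono (subset_univ _) x y hxy⟩
  · rw [mem_preimage] at hx
    obtain ⟨hx1, hx0, hx0'⟩ := hx
    simp only [hw, Pi.add_apply, Matrix.cons_val_one, Matrix.cons_val_zero,
      add_zero] at hx1 hx0 hx0'
    rw [mem_box]
    intro i
    fin_cases i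
    · simp only [Fin.zero_eta, Fin.isValue]
      omega
    · simp only [Fin.mk_one, Fin.isValue]
      omega
  · intro hyb
    rw [mem_box] at hyb
    have h0 := hyb 0
    have h1 := hyb 1
    rw [mem_preimage] at hy
    have hfar := hT _ hy
    simp only [hw, Pi.add_apply, Matrix.cons_val_one, Matrix.cons_val_zero,
      add_zero, add_sub_cancel_right] at hfar
    rcases hfar with hf | hf
    · rcases lt_abs.mp hf with hf' | hf' <;> omega
    · rcases lt_abs.mp hf with hf' | hf' <;> omega

end Summit.CriticalPhenomena.CardyFormulaZ2.Cruxes.HalfPlaneMarkDensityLaw.SketchLine.SelfDual
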